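import Mathlib
import Summits.QuantumAdvantage.QuantumAdvantage.Theorems.MobiusLadderQuadraticDigitPhasesStubTameCoreDigits
import Summits.QuantumAdvantage.QuantumAdvantage.Theorems.MobiusLadderQuadraticDigitPhasesStubTameCorePhase

/-!
# Tame core campaign, file 4: the flip group on good inputs (toward `stub_tameCore` / `stub_cellTame`)

Helper file of the campaign proving the registered stubs `stub_tameCore` / `stub_cellTame` of the crux
`MobiusLadder.QuadraticDigitPhases` (stmt-QuantumAdvantage-1391), line `Sketch`; built on the landed campaign
files `…StubTameCoreDigits` (digits and carries under input-bit flips) and `…StubTameCorePhase` (phase algebra,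
tame index lemmas).

Setting (one register, multiplier `p` odd): digits `y T j = bit_j(pT)`, the truncated change vector `Δ b T` of
the flip at `b` (window `L`), the quadratic phase `Φ[Y]` with coefficients `a`, linear data `l`, and the PHASE
CHANGE FUNCTIONAL `G b T = Σ_i (Σ_j Aˢʸᵐ i j (Δ b T)_j) (y T)_i + Φ[Δ b T]`.  All objects are passed as
functions together with their defining equations (`hy`, `hΔ`, `hΦ`, `hG`).  A separated family `B` of sources
(gaps `> L + s`, windows below `N`) is TAME when every junk position `j ∈ (b, b+L]` interacts only within
distance `s`; an input `T` is GOOD when every pattern `pT ⊕ p(T ⊕ 2^b)`, `b ∈ B`, is confined to `[b, b+L]`.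

* single flips on good inputs: `y (T ⊕ 2^b) = y T + Δ b T` (`digit_single`), `Φ[y (T ⊕ 2^b)] = Φ[y T] + G b T`
  (`phase_single`), goodness and all change vectors are invariant (`good_single`, `delta_single`), and
  `G b (T ⊕ 2^(b')) = G b T + Aˢʸᵐ b' b` (`G_single`: the cross term of `…StubTameCorePhase.cross_sum`; for
  `b' = b` the symmetry of the second difference);
* multi-flips `T ↦ T ⊕ Σ_{b ∈ u} 2^b`, `u ⊆ B` (induction on `u`): goodness (`good_multi`), change vectors
  (`delta_multi`), digits `y (σ_u T) = y T + Σ_{b∈u} Δ b T` (`digit_multi`), `G b (σ_u T) = G b T + Σ_{b'∈u} Aˢʸᵐ b' b`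
  (`G_multi`), high quotients (`div_multi`);
* two registers: the TOTAL phase changes by the total functional, `Φtot (σ_u T) = Φtot T + Σ_{b∈u} (Gᵖ b T + Gq b T)`
  (`phase_multi`: the register copies of the cross terms cancel in characteristic two), and the total functional
  is invariant under every multi-flip (`Gtot_multi`);
* an INERT window has `G b T = Σ_i Aˢʸᵐ i b (y T)_i + l b` for every input (`G_inert`).
-/

set_option linter.dupNamespace false -- D-0017: single-problem summit ⇒ `QuantumAdvantage.QuantumAdvantage` by design

namespace Summit.QuantumAdvantage.QuantumAdvantage.Theorems.MobiusLadderQuadraticDigitPhasesStubTameCoreFlip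

open Finset
open Summit.QuantumAdvantage.QuantumAdvantage.Theorems.MobiusLadderQuadraticDigitPhasesStubTameCoreDigits
  (digit_flip_good pattern_flip_of_sep delta_flip_of_sep div_eq_of_good xor_mask_insert pattern_flip_self)
open Summit.QuantumAdvantage.QuantumAdvantage.Theorems.MobiusLadderQuadraticDigitPhasesStubTameCorePhase
  (expansion cross_sum coef_inert phase_inert asym_symm)

/-! ## The truncated change vector -/

/-- The change vector has the source entry `1`. -/
theorem delta_self (p L : ℕ) (Δ : ℕ → ℕ → ℕ → ZMod 2)
    (hΔ : ∀ b T j, Δ b T j = if j = b then 1 else if b < j ∧ j ≤ b + L then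
      ((p * ((T ^^^ 2 ^ b) % 2 ^ j) / 2 ^ j : ℕ) : ZMod 2) + ((p * (T % 2 ^ j) / 2 ^ j : ℕ) : ZMod 2) else 0)
    (b T : ℕ) : Δ b T b = 1 := by
  rw [hΔ, if_pos rfl]

/-- The change vector is supported on the window `[b, b+L]`. -/
theorem delta_supp (p L : ℕ) (Δ : ℕ → ℕ → ℕ → ZMod 2)
    (hΔ : ∀ b T j, Δ b T j = if j = b then 1 else if b < j ∧ j ≤ b + L then
      ((p * ((T ^^^ 2 ^ b) % 2 ^ j) / 2 ^ j : ℕ) : ZMod 2) + ((p * (T % 2 ^ j) / 2 ^ j : ℕ) : ZMod 2) else 0)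
    (b T j : ℕ) (h : Δ b T j ≠ 0) : b ≤ j ∧ j ≤ b + L := by
  rw [hΔ] at h
  by_cases hjb : j = b
  · subst hjb; exact ⟨le_rfl, Nat.le_add_right _ _⟩
  rw [if_neg hjb] at h
  by_cases hj : b < j ∧ j ≤ b + L
  · exact ⟨hj.1.le, hj.2⟩
  · rw [if_neg hj] at h; exact absurd rfl h

/-- Trichotomy of two sources of a separated family: equal, or more than `L` apart on either side. -/
theorem sep_cases (B : Finset ℕ) (L s : ℕ) (hsep : ∀ b ∈ B, ∀ b' ∈ B, b < b' → L + s < b' - b)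
    {b b' : ℕ} (hb : b ∈ B) (hb' : b' ∈ B) : b = b' ∨ b + L < b' ∨ b' + L < b := by
  rcases lt_trichotomy b b' with h | h | h
  · have := hsep b hb b' hb' h; omega
  · exact Or.inl h
  · have := hsep b' hb' b hb h; omega

/-! ## Single flips on good inputs (one register) -/

/-- DIGITS under a single good flip: `y (T ⊕ 2^b) = y T + Δ b T`. -/
theorem digit_single (p L : ℕ) (hp : Odd p) (y : ℕ → ℕ → ZMod 2)
    (hy : ∀ T j, y T j = if Nat.testBit (p * T) j then 1 else 0) (Δ : ℕ → ℕ → ℕ → ZMod 2)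
    (hΔ : ∀ b T j, Δ b T j = if j = b then 1 else if b < j ∧ j ≤ b + L then
      ((p * ((T ^^^ 2 ^ b) % 2 ^ j) / 2 ^ j : ℕ) : ZMod 2) + ((p * (T % 2 ^ j) / 2 ^ j : ℕ) : ZMod 2) else 0)
    (b T : ℕ) (hgood : (p * T) ^^^ (p * (T ^^^ 2 ^ b)) < 2 ^ (b + L + 1)) (j : ℕ) :
    y (T ^^^ 2 ^ b) j = y T j + Δ b T j := by
  rw [hy, hy, hΔ]
  exact digit_flip_good p b L T j hp hgood

/-- PHASE under a single good flip: `Φ[y (T ⊕ 2^b)] = Φ[y T] + G b T` (first-order expansion). -/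
theorem phase_single (p N L : ℕ) (hp : Odd p) (a : ℕ → ℕ → ZMod 2) (l : ℕ → ZMod 2)
    (y : ℕ → ℕ → ZMod 2) (hy : ∀ T j, y T j = if Nat.testBit (p * T) j then 1 else 0)
    (Δ : ℕ → ℕ → ℕ → ZMod 2)
    (hΔ : ∀ b T j, Δ b T j = if j = b then 1 else if b < j ∧ j ≤ b + L then
      ((p * ((T ^^^ 2 ^ b) % 2 ^ j) / 2 ^ j : ℕ) : ZMod 2) + ((p * (T % 2 ^ j) / 2 ^ j : ℕ) : ZMod 2) else 0)
    (Φ : (ℕ → ZMod 2) → ZMod 2)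
    (hΦ : ∀ Y, Φ Y = ∑ i ∈ range N, ∑ j ∈ range N, (if i < j then a i j * Y i * Y j else 0) +
      ∑ i ∈ range N, l i * Y i)
    (G : ℕ → ℕ → ZMod 2)
    (hG : ∀ b T, G b T = ∑ i ∈ range N, (∑ j ∈ range N,
      (if i < j then a i j else if j < i then a j i else 0) * Δ b T j) * y T i + Φ (Δ b T))
    (b T : ℕ) (hgood : (p * T) ^^^ (p * (T ^^^ 2 ^ b)) < 2 ^ (b + L + 1)) :
    Φ (y (T ^^^ 2 ^ b)) = Φ (y T) + G b T := by
  have hfun : y (T ^^^ 2 ^ b) = fun j => y T j + Δ b T j :=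
    funext fun j => digit_single p L hp y hy Δ hΔ b T hgood j
  rw [hfun, hΦ, hG, hΦ, hΦ, expansion N a l (y T) (Δ b T)]
  ring

/-- GOODNESS is invariant under the flips of the family. -/
theorem good_single (p L s : ℕ) (B : Finset ℕ) (hsep : ∀ b ∈ B, ∀ b' ∈ B, b < b' → L + s < b' - b)
    (T : ℕ) (hgood : ∀ b ∈ B, (p * T) ^^^ (p * (T ^^^ 2 ^ b)) < 2 ^ (b + L + 1))
    {b' : ℕ} (hb' : b' ∈ B) :
    ∀ b ∈ B, (p * (T ^^^ 2 ^ b')) ^^^ (p * ((T ^^^ 2 ^ b') ^^^ 2 ^ b)) < 2 ^ (b + L + 1) := by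
  intro b hb
  rw [pattern_flip_of_sep p T b b' L (hgood b hb) (hgood b' hb') (sep_cases B L s hsep hb hb')]
  exact hgood b hb

/-- CHANGE VECTORS are invariant under the flips of the family (on good inputs). -/
theorem delta_single (p L s : ℕ) (B : Finset ℕ) (hsep : ∀ b ∈ B, ∀ b' ∈ B, b < b' → L + s < b' - b)
    (Δ : ℕ → ℕ → ℕ → ZMod 2)
    (hΔ : ∀ b T j, Δ b T j = if j = b then 1 else if b < j ∧ j ≤ b + L then
      ((p * ((T ^^^ 2 ^ b) % 2 ^ j) / 2 ^ j : ℕ) : ZMod 2) + ((p * (T % 2 ^ j) / 2 ^ j : ℕ) : ZMod 2) else 0)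
    (T : ℕ) (hgood : ∀ b ∈ B, (p * T) ^^^ (p * (T ^^^ 2 ^ b)) < 2 ^ (b + L + 1))
    {b b' : ℕ} (hb : b ∈ B) (hb' : b' ∈ B) (j : ℕ) : Δ b (T ^^^ 2 ^ b') j = Δ b T j := by
  rw [hΔ, hΔ]
  exact delta_flip_of_sep p T b b' L (hgood b' hb') (sep_cases B L s hsep hb hb') j

/-- THE FUNCTIONAL under a single flip of the family: `G b (T ⊕ 2^(b')) = G b T + Aˢʸᵐ b' b` (one register; the
`p`- and `q`-copies of the source–source entry cancel).  For `b' ≠ b` this is the cross term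
(`cross_sum`); for `b' = b` both sides are the second difference of the phase. -/
theorem G_single (p N L s : ℕ) (hp : Odd p) (a : ℕ → ℕ → ZMod 2) (l : ℕ → ZMod 2) (B : Finset ℕ)
    (hT : ∀ b ∈ B, ∀ j, b < j → j ≤ b + L → ∀ i, i < N → (a i j ≠ 0 ∨ a j i ≠ 0) → Nat.dist i j ≤ s)
    (hsep : ∀ b ∈ B, ∀ b' ∈ B, b < b' → L + s < b' - b) (hBN : ∀ b ∈ B, b + L < N)
    (y : ℕ → ℕ → ZMod 2) (hy : ∀ T j, y T j = if Nat.testBit (p * T) j then 1 else 0)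
    (Δ : ℕ → ℕ → ℕ → ZMod 2)
    (hΔ : ∀ b T j, Δ b T j = if j = b then 1 else if b < j ∧ j ≤ b + L then
      ((p * ((T ^^^ 2 ^ b) % 2 ^ j) / 2 ^ j : ℕ) : ZMod 2) + ((p * (T % 2 ^ j) / 2 ^ j : ℕ) : ZMod 2) else 0)
    (Φ : (ℕ → ZMod 2) → ZMod 2)
    (hΦ : ∀ Y, Φ Y = ∑ i ∈ range N, ∑ j ∈ range N, (if i < j then a i j * Y i * Y j else 0) +
      ∑ i ∈ range N, l i * Y i)
    (G : ℕ → ℕ → ZMod 2)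
    (hG : ∀ b T, G b T = ∑ i ∈ range N, (∑ j ∈ range N,
      (if i < j then a i j else if j < i then a j i else 0) * Δ b T j) * y T i + Φ (Δ b T))
    (T : ℕ) (hgood : ∀ b ∈ B, (p * T) ^^^ (p * (T ^^^ 2 ^ b)) < 2 ^ (b + L + 1))
    {b b' : ℕ} (hb : b ∈ B) (hb' : b' ∈ B) :
    G b (T ^^^ 2 ^ b') = G b T + (if b' < b then a b' b else if b < b' then a b b' else 0) := by
  by_cases hne : b = b'
  · subst hne
    have h1 := phase_single p N L hp a l y hy Δ hΔ Φ hΦ G hG b T (hgood b hb)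
    have h2 := phase_single p N L hp a l y hy Δ hΔ Φ hΦ G hG b (T ^^^ 2 ^ b)
      (by rw [pattern_flip_self]; exact hgood b hb)
    rw [Nat.xor_xor_cancel_right, h1] at h2
    rw [if_neg (lt_irrefl b), if_neg (lt_irrefl b), add_zero]
    have h3 := CharTwo.add_self_eq_zero (G b T)
    linear_combination -h2 - h3
  · have hΔinv : Δ b (T ^^^ 2 ^ b') = Δ b T := funext fun j => delta_single p L s B hsep Δ hΔ T hgood hb hb' j
    have hy' : ∀ i, y (T ^^^ 2 ^ b') i = y T i + Δ b' T i :=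
      fun i => digit_single p L hp y hy Δ hΔ b' T (hgood b' hb') i
    rw [hG, hG, hΔinv]
    simp only [hy', mul_add, sum_add_distrib]
    rw [cross_sum a B L s N hT hsep hb hb' hne (by have := hBN b hb; omega) (by have := hBN b' hb'; omega)
      (Δ b T) (Δ b' T) (delta_self p L Δ hΔ b T) (fun j hj => delta_supp p L Δ hΔ b T j hj)
      (delta_self p L Δ hΔ b' T) (fun j hj => delta_supp p L Δ hΔ b' T j hj)]
    ring

/-! ## Multi-flips (one register) -/

/-- GOODNESS is invariant under the multi-flips `T ↦ T ⊕ Σ_{b∈u} 2^b`, `u ⊆ B`. -/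
theorem good_multi (p L s : ℕ) (B : Finset ℕ) (hsep : ∀ b ∈ B, ∀ b' ∈ B, b < b' → L + s < b' - b)
    (T : ℕ) (hgood : ∀ b ∈ B, (p * T) ^^^ (p * (T ^^^ 2 ^ b)) < 2 ^ (b + L + 1)) :
    ∀ u, u ⊆ B → ∀ b ∈ B, (p * (T ^^^ ∑ x ∈ u, 2 ^ x)) ^^^ (p * ((T ^^^ ∑ x ∈ u, 2 ^ x) ^^^ 2 ^ b)) <
      2 ^ (b + L + 1) := by
  intro u
  induction u using Finset.induction_on with
  | empty => intro _; simpa using hgood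
  | insert b' u hb'u ih =>
    intro hsub
    rw [xor_mask_insert T b' u hb'u]
    exact good_single p L s B hsep _ (ih ((subset_insert _ _).trans hsub)) (hsub (mem_insert_self _ _))

/-- CHANGE VECTORS are invariant under the multi-flips. -/
theorem delta_multi (p L s : ℕ) (B : Finset ℕ) (hsep : ∀ b ∈ B, ∀ b' ∈ B, b < b' → L + s < b' - b)
    (Δ : ℕ → ℕ → ℕ → ZMod 2)
    (hΔ : ∀ b T j, Δ b T j = if j = b then 1 else if b < j ∧ j ≤ b + L then
      ((p * ((T ^^^ 2 ^ b) % 2 ^ j) / 2 ^ j : ℕ) : ZMod 2) + ((p * (T % 2 ^ j) / 2 ^ j : ℕ) : ZMod 2) else 0)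
    (T : ℕ) (hgood : ∀ b ∈ B, (p * T) ^^^ (p * (T ^^^ 2 ^ b)) < 2 ^ (b + L + 1)) :
    ∀ u, u ⊆ B → ∀ b ∈ B, ∀ j, Δ b (T ^^^ ∑ x ∈ u, 2 ^ x) j = Δ b T j := by
  intro u
  induction u using Finset.induction_on with
  | empty => intro _ b _ j; simp
  | insert b' u hb'u ih =>
    intro hsub b hb j
    have hsub' : u ⊆ B := (subset_insert _ _).trans hsub
    rw [xor_mask_insert T b' u hb'u,
      delta_single p L s B hsep Δ hΔ _ (good_multi p L s B hsep T hgood u hsub') hb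
        (hsub (mem_insert_self _ _)) j, ih hsub' b hb j]

/-- DIGITS under a multi-flip: `y (σ_u T) = y T + Σ_{b∈u} Δ b T`. -/
theorem digit_multi (p L s : ℕ) (hp : Odd p) (B : Finset ℕ)
    (hsep : ∀ b ∈ B, ∀ b' ∈ B, b < b' → L + s < b' - b)
    (y : ℕ → ℕ → ZMod 2) (hy : ∀ T j, y T j = if Nat.testBit (p * T) j then 1 else 0)
    (Δ : ℕ → ℕ → ℕ → ZMod 2)
    (hΔ : ∀ b T j, Δ b T j = if j = b then 1 else if b < j ∧ j ≤ b + L then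
      ((p * ((T ^^^ 2 ^ b) % 2 ^ j) / 2 ^ j : ℕ) : ZMod 2) + ((p * (T % 2 ^ j) / 2 ^ j : ℕ) : ZMod 2) else 0)
    (T : ℕ) (hgood : ∀ b ∈ B, (p * T) ^^^ (p * (T ^^^ 2 ^ b)) < 2 ^ (b + L + 1)) :
    ∀ u, u ⊆ B → ∀ i, y (T ^^^ ∑ x ∈ u, 2 ^ x) i = y T i + ∑ b ∈ u, Δ b T i := by
  intro u
  induction u using Finset.induction_on with
  | empty => intro _ i; simp
  | insert b' u hb'u ih =>
    intro hsub i
    have hsub' : u ⊆ B := (subset_insert _ _).trans hsub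
    have hb' : b' ∈ B := hsub (mem_insert_self _ _)
    rw [xor_mask_insert T b' u hb'u,
      digit_single p L hp y hy Δ hΔ b' _ (good_multi p L s B hsep T hgood u hsub' b' hb') i,
      delta_multi p L s B hsep Δ hΔ T hgood u hsub' b' hb' i, ih hsub' i, sum_insert hb'u]
    ring

/-- THE FUNCTIONAL under a multi-flip: `G b (σ_u T) = G b T + Σ_{b'∈u} Aˢʸᵐ b' b` (one register). -/
theorem G_multi (p N L s : ℕ) (hp : Odd p) (a : ℕ → ℕ → ZMod 2) (l : ℕ → ZMod 2) (B : Finset ℕ)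
    (hT : ∀ b ∈ B, ∀ j, b < j → j ≤ b + L → ∀ i, i < N → (a i j ≠ 0 ∨ a j i ≠ 0) → Nat.dist i j ≤ s)
    (hsep : ∀ b ∈ B, ∀ b' ∈ B, b < b' → L + s < b' - b) (hBN : ∀ b ∈ B, b + L < N)
    (y : ℕ → ℕ → ZMod 2) (hy : ∀ T j, y T j = if Nat.testBit (p * T) j then 1 else 0)
    (Δ : ℕ → ℕ → ℕ → ZMod 2)
    (hΔ : ∀ b T j, Δ b T j = if j = b then 1 else if b < j ∧ j ≤ b + L then
      ((p * ((T ^^^ 2 ^ b) % 2 ^ j) / 2 ^ j : ℕ) : ZMod 2) + ((p * (T % 2 ^ j) / 2 ^ j : ℕ) : ZMod 2) else 0)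
    (Φ : (ℕ → ZMod 2) → ZMod 2)
    (hΦ : ∀ Y, Φ Y = ∑ i ∈ range N, ∑ j ∈ range N, (if i < j then a i j * Y i * Y j else 0) +
      ∑ i ∈ range N, l i * Y i)
    (G : ℕ → ℕ → ZMod 2)
    (hG : ∀ b T, G b T = ∑ i ∈ range N, (∑ j ∈ range N,
      (if i < j then a i j else if j < i then a j i else 0) * Δ b T j) * y T i + Φ (Δ b T))
    (T : ℕ) (hgood : ∀ b ∈ B, (p * T) ^^^ (p * (T ^^^ 2 ^ b)) < 2 ^ (b + L + 1)) :
    ∀ u, u ⊆ B → ∀ b ∈ B, G b (T ^^^ ∑ x ∈ u, 2 ^ x) =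
      G b T + ∑ b' ∈ u, (if b' < b then a b' b else if b < b' then a b b' else 0) := by
  intro u
  induction u using Finset.induction_on with
  | empty => intro _ b _; simp
  | insert b' u hb'u ih =>
    intro hsub b hb
    have hsub' : u ⊆ B := (subset_insert _ _).trans hsub
    have hb' : b' ∈ B := hsub (mem_insert_self _ _)
    rw [xor_mask_insert T b' u hb'u,
      G_single p N L s hp a l B hT hsep hBN y hy Δ hΔ Φ hΦ G hG _ (good_multi p L s B hsep T hgood u hsub')
        hb hb', ih hsub' b hb, sum_insert hb'u]
    ring

/-- HIGH QUOTIENTS `⌊p(σ_u T)/2^K⌋` above all windows are invariant under the multi-flips. -/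
theorem div_multi (p L s : ℕ) (B : Finset ℕ) (hsep : ∀ b ∈ B, ∀ b' ∈ B, b < b' → L + s < b' - b)
    (T : ℕ) (hgood : ∀ b ∈ B, (p * T) ^^^ (p * (T ^^^ 2 ^ b)) < 2 ^ (b + L + 1)) (K : ℕ)
    (hK : ∀ b ∈ B, b + L + 1 ≤ K) :
    ∀ u, u ⊆ B → p * (T ^^^ ∑ x ∈ u, 2 ^ x) / 2 ^ K = p * T / 2 ^ K := by
  intro u
  induction u using Finset.induction_on with
  | empty => intro _; simp
  | insert b' u hb'u ih =>
    intro hsub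
    have hsub' : u ⊆ B := (subset_insert _ _).trans hsub
    have hb' : b' ∈ B := hsub (mem_insert_self _ _)
    rw [xor_mask_insert T b' u hb'u,
      div_eq_of_good p _ b' L K (hK b' hb') (good_multi p L s B hsep T hgood u hsub' b' hb'), ih hsub']

/-! ## Two registers: the total phase and the total functional -/

/-- THE TOTAL PHASE under a multi-flip: with two registers (multipliers `p`, `q`, linear data `l₁`, `l₂`, the
same quadratic coefficients `a`), `Φ[y (σ_u T)] + Φ'[y' (σ_u T)] = Φ[y T] + Φ'[y' T] + Σ_{b∈u} (G b T + G' b T)`: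
the register copies of the source–source cross terms cancel. -/
theorem phase_multi (p q N L s : ℕ) (hp : Odd p) (hq : Odd q) (a : ℕ → ℕ → ZMod 2) (l₁ l₂ : ℕ → ZMod 2)
    (B : Finset ℕ)
    (hT : ∀ b ∈ B, ∀ j, b < j → j ≤ b + L → ∀ i, i < N → (a i j ≠ 0 ∨ a j i ≠ 0) → Nat.dist i j ≤ s)
    (hsep : ∀ b ∈ B, ∀ b' ∈ B, b < b' → L + s < b' - b) (hBN : ∀ b ∈ B, b + L < N)
    (y : ℕ → ℕ → ZMod 2) (hy : ∀ T j, y T j = if Nat.testBit (p * T) j then 1 else 0)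
    (Δ : ℕ → ℕ → ℕ → ZMod 2)
    (hΔ : ∀ b T j, Δ b T j = if j = b then 1 else if b < j ∧ j ≤ b + L then
      ((p * ((T ^^^ 2 ^ b) % 2 ^ j) / 2 ^ j : ℕ) : ZMod 2) + ((p * (T % 2 ^ j) / 2 ^ j : ℕ) : ZMod 2) else 0)
    (Φ : (ℕ → ZMod 2) → ZMod 2)
    (hΦ : ∀ Y, Φ Y = ∑ i ∈ range N, ∑ j ∈ range N, (if i < j then a i j * Y i * Y j else 0) +
      ∑ i ∈ range N, l₁ i * Y i)
    (G : ℕ → ℕ → ZMod 2)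
    (hG : ∀ b T, G b T = ∑ i ∈ range N, (∑ j ∈ range N,
      (if i < j then a i j else if j < i then a j i else 0) * Δ b T j) * y T i + Φ (Δ b T))
    (y' : ℕ → ℕ → ZMod 2) (hy' : ∀ T j, y' T j = if Nat.testBit (q * T) j then 1 else 0)
    (Δ' : ℕ → ℕ → ℕ → ZMod 2)
    (hΔ' : ∀ b T j, Δ' b T j = if j = b then 1 else if b < j ∧ j ≤ b + L then
      ((q * ((T ^^^ 2 ^ b) % 2 ^ j) / 2 ^ j : ℕ) : ZMod 2) + ((q * (T % 2 ^ j) / 2 ^ j : ℕ) : ZMod 2) else 0)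
    (Φ' : (ℕ → ZMod 2) → ZMod 2)
    (hΦ' : ∀ Y, Φ' Y = ∑ i ∈ range N, ∑ j ∈ range N, (if i < j then a i j * Y i * Y j else 0) +
      ∑ i ∈ range N, l₂ i * Y i)
    (G' : ℕ → ℕ → ZMod 2)
    (hG' : ∀ b T, G' b T = ∑ i ∈ range N, (∑ j ∈ range N,
      (if i < j then a i j else if j < i then a j i else 0) * Δ' b T j) * y' T i + Φ' (Δ' b T))
    (T : ℕ) (hgood : ∀ b ∈ B, (p * T) ^^^ (p * (T ^^^ 2 ^ b)) < 2 ^ (b + L + 1))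
    (hgood' : ∀ b ∈ B, (q * T) ^^^ (q * (T ^^^ 2 ^ b)) < 2 ^ (b + L + 1)) :
    ∀ u, u ⊆ B → Φ (y (T ^^^ ∑ x ∈ u, 2 ^ x)) + Φ' (y' (T ^^^ ∑ x ∈ u, 2 ^ x)) =
      Φ (y T) + Φ' (y' T) + ∑ b ∈ u, (G b T + G' b T) := by
  intro u
  induction u using Finset.induction_on with
  | empty => intro _; simp
  | insert b' u hb'u ih =>
    intro hsub
    have hsub' : u ⊆ B := (subset_insert _ _).trans hsub
    have hb' : b' ∈ B := hsub (mem_insert_self _ _)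
    have hg1 := good_multi p L s B hsep T hgood u hsub'
    have hg2 := good_multi q L s B hsep T hgood' u hsub'
    rw [xor_mask_insert T b' u hb'u, phase_single p N L hp a l₁ y hy Δ hΔ Φ hΦ G hG b' _ (hg1 b' hb'),
      phase_single q N L hq a l₂ y' hy' Δ' hΔ' Φ' hΦ' G' hG' b' _ (hg2 b' hb'),
      G_multi p N L s hp a l₁ B hT hsep hBN y hy Δ hΔ Φ hΦ G hG T hgood u hsub' b' hb',
      G_multi q N L s hq a l₂ B hT hsep hBN y' hy' Δ' hΔ' Φ' hΦ' G' hG' T hgood' u hsub' b' hb',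
      sum_insert hb'u]
    have h2 := CharTwo.add_self_eq_zero
      (∑ x ∈ u, (if x < b' then a x b' else if b' < x then a b' x else 0))
    linear_combination ih hsub' + h2

/-- THE TOTAL FUNCTIONAL is invariant under every multi-flip of the family. -/
theorem Gtot_multi (p q N L s : ℕ) (hp : Odd p) (hq : Odd q) (a : ℕ → ℕ → ZMod 2) (l₁ l₂ : ℕ → ZMod 2)
    (B : Finset ℕ)
    (hT : ∀ b ∈ B, ∀ j, b < j → j ≤ b + L → ∀ i, i < N → (a i j ≠ 0 ∨ a j i ≠ 0) → Nat.dist i j ≤ s)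
    (hsep : ∀ b ∈ B, ∀ b' ∈ B, b < b' → L + s < b' - b) (hBN : ∀ b ∈ B, b + L < N)
    (y : ℕ → ℕ → ZMod 2) (hy : ∀ T j, y T j = if Nat.testBit (p * T) j then 1 else 0)
    (Δ : ℕ → ℕ → ℕ → ZMod 2)
    (hΔ : ∀ b T j, Δ b T j = if j = b then 1 else if b < j ∧ j ≤ b + L then
      ((p * ((T ^^^ 2 ^ b) % 2 ^ j) / 2 ^ j : ℕ) : ZMod 2) + ((p * (T % 2 ^ j) / 2 ^ j : ℕ) : ZMod 2) else 0)
    (Φ : (ℕ → ZMod 2) → ZMod 2)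
    (hΦ : ∀ Y, Φ Y = ∑ i ∈ range N, ∑ j ∈ range N, (if i < j then a i j * Y i * Y j else 0) +
      ∑ i ∈ range N, l₁ i * Y i)
    (G : ℕ → ℕ → ZMod 2)
    (hG : ∀ b T, G b T = ∑ i ∈ range N, (∑ j ∈ range N,
      (if i < j then a i j else if j < i then a j i else 0) * Δ b T j) * y T i + Φ (Δ b T))
    (y' : ℕ → ℕ → ZMod 2) (hy' : ∀ T j, y' T j = if Nat.testBit (q * T) j then 1 else 0)
    (Δ' : ℕ → ℕ → ℕ → ZMod 2)
    (hΔ' : ∀ b T j, Δ' b T j = if j = b then 1 else if b < j ∧ j ≤ b + L then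
      ((q * ((T ^^^ 2 ^ b) % 2 ^ j) / 2 ^ j : ℕ) : ZMod 2) + ((q * (T % 2 ^ j) / 2 ^ j : ℕ) : ZMod 2) else 0)
    (Φ' : (ℕ → ZMod 2) → ZMod 2)
    (hΦ' : ∀ Y, Φ' Y = ∑ i ∈ range N, ∑ j ∈ range N, (if i < j then a i j * Y i * Y j else 0) +
      ∑ i ∈ range N, l₂ i * Y i)
    (G' : ℕ → ℕ → ZMod 2)
    (hG' : ∀ b T, G' b T = ∑ i ∈ range N, (∑ j ∈ range N,
      (if i < j then a i j else if j < i then a j i else 0) * Δ' b T j) * y' T i + Φ' (Δ' b T))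
    (T : ℕ) (hgood : ∀ b ∈ B, (p * T) ^^^ (p * (T ^^^ 2 ^ b)) < 2 ^ (b + L + 1))
    (hgood' : ∀ b ∈ B, (q * T) ^^^ (q * (T ^^^ 2 ^ b)) < 2 ^ (b + L + 1))
    (u : Finset ℕ) (hu : u ⊆ B) {b : ℕ} (hb : b ∈ B) :
    G b (T ^^^ ∑ x ∈ u, 2 ^ x) + G' b (T ^^^ ∑ x ∈ u, 2 ^ x) = G b T + G' b T := by
  rw [G_multi p N L s hp a l₁ B hT hsep hBN y hy Δ hΔ Φ hΦ G hG T hgood u hu b hb,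
    G_multi q N L s hq a l₂ B hT hsep hBN y' hy' Δ' hΔ' Φ' hΦ' G' hG' T hgood' u hu b hb]
  have h2 := CharTwo.add_self_eq_zero (∑ x ∈ u, (if x < b then a x b else if b < x then a b x else 0))
  linear_combination h2

/-! ## Inert windows -/

/-- AN INERT WINDOW (no interactions of the junk below `N`, no linear terms on the junk) has the bare
functional `G b T = Σ_i Aˢʸᵐ i b (y T)_i + l b` on every input. -/
theorem G_inert (p N L : ℕ) (a : ℕ → ℕ → ZMod 2) (l : ℕ → ZMod 2)
    (y : ℕ → ℕ → ZMod 2) (Δ : ℕ → ℕ → ℕ → ZMod 2)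
    (hΔ : ∀ b T j, Δ b T j = if j = b then 1 else if b < j ∧ j ≤ b + L then
      ((p * ((T ^^^ 2 ^ b) % 2 ^ j) / 2 ^ j : ℕ) : ZMod 2) + ((p * (T % 2 ^ j) / 2 ^ j : ℕ) : ZMod 2) else 0)
    (Φ : (ℕ → ZMod 2) → ZMod 2)
    (hΦ : ∀ Y, Φ Y = ∑ i ∈ range N, ∑ j ∈ range N, (if i < j then a i j * Y i * Y j else 0) +
      ∑ i ∈ range N, l i * Y i)
    (G : ℕ → ℕ → ZMod 2)
    (hG : ∀ b T, G b T = ∑ i ∈ range N, (∑ j ∈ range N,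
      (if i < j then a i j else if j < i then a j i else 0) * Δ b T j) * y T i + Φ (Δ b T))
    {b : ℕ} (hbN : b < N)
    (hin : ∀ j, b < j → j ≤ b + L → l j = 0 ∧ ∀ i', i' < N → a i' j = 0 ∧ a j i' = 0) (T : ℕ) :
    G b T = ∑ i ∈ range N, (if i < b then a i b else if b < i then a b i else 0) * y T i + l b := by
  rw [hG, hΦ, phase_inert a l N b L (Δ b T) hbN (delta_self p L Δ hΔ b T)
    (fun j hj => delta_supp p L Δ hΔ b T j hj) hin]
  congr 1
  refine sum_congr rfl fun i hi => ?_
  rw [coef_inert a N b L (Δ b T) hbN (delta_self p L Δ hΔ b T) (fun j hj => delta_supp p L Δ hΔ b T j hj)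
    (fun j h1 h2 i' hi' => (hin j h1 h2).2 i' hi') i (mem_range.mp hi)]

/-- MAIN STATEMENT of this helper file (registered campaign stub toward `stub_tameCore`): goodness of an input with
respect to a separated family of flip positions is invariant under all multi-flips of the family. -/
theorem stub_tameCoreFlip : ∀ (p L s : ℕ) (B : Finset ℕ), (∀ b ∈ B, ∀ b' ∈ B, b < b' → L + s < b' - b) → ∀ (T : ℕ), (∀ b ∈ B, (p * T) ^^^ (p * (T ^^^ 2 ^ b)) < 2 ^ (b + L + 1)) → ∀ u, u ⊆ B → ∀ b ∈ B, (p * (T ^^^ ∑ x ∈ u, 2 ^ x)) ^^^ (p * ((T ^^^ ∑ x ∈ u, 2 ^ x) ^^^ 2 ^ b)) < 2 ^ (b + L + 1) := by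
  intro p L s B hsep T hgood u hu b hb
  exact good_multi p L s B hsep T hgood u hu b hb

end Summit.QuantumAdvantage.QuantumAdvantage.Theorems.MobiusLadderQuadraticDigitPhasesStubTameCoreFlip
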